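import Mathlib
import Summits.CriticalPhenomena.SAWScalingLimit.Theorems.ObservableToSLE.Negative.NoCutPoint

/-!
# The first exploration step already leaves the hypothesis class (crux `ObservableToSLE`,
stmt-CriticalPhenomena-10472; obstruction W1 for EVERY domain)

Negative lemma (refuter, cdisprove gen 3), generalising `slitDisc_ne_carrier`
(`Negative.HypothesisSilence`) from the slit disc to every domain and every first step:

* `slitSegment_ne_carrier` — for every Dobrushin domain `D` and every nondegenerate segment
  `[p, q]` whose half-open part `(p, q]` lies in `D` (e.g. `p` a frontier point and `[p, q]` the
  first rescaled lattice edge of an exploration from `p`; `p` may also be interior), the slit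
  domain `D.carrier ∖ [p, q]` is the carrier of NO Dobrushin domain: the midpoint of the slit is
  a cut point of the frontier (`carrier_ne_of_cutPoint`, `Negative.NoCutPoint`).

Consequence for provers: `HexObservableLimit` (quantified `∀ D : DobrushinDomain`) says nothing
about `Ω ∖ γ[0, 1]`, the domain of the observable martingale after ONE step, in ANY domain `Ω`;
every martingale line must manufacture its own slit-domain observable convergence.

Auxiliary: sideways approach `lineMap_mem_closure_slit`, `frontier_slit_subset`.
-/

noncomputable section

open Literature.Probability.RandomPlanarGeometry MeasureTheory Filter Topology Set
open scoped ComplexConjugate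

namespace Summit.CriticalPhenomena.SAWScalingLimit.Theorems.ObservableToSLE.Negative

/-! ### Geometry of a segment `[p, q] ⊂ ℂ` -/

section Segment

variable {p q : ℂ}

/-- Points of `segment ℝ p q` are `p + t (q - p)`, `t ∈ [0, 1]`. [folklore] -/
theorem mem_segment_iff_exists (z : ℂ) :
    z ∈ segment ℝ p q ↔ ∃ t ∈ Set.Icc (0 : ℝ) 1, z = p + (t : ℂ) * (q - p) := by
  rw [segment_eq_image']
  constructor
  · rintro ⟨t, ht, rfl⟩
    exact ⟨t, ht, by simp [Complex.real_smul]⟩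
  · rintro ⟨t, ht, rfl⟩
    exact ⟨t, ht, by simp [Complex.real_smul]⟩

/-- A point `p + (t + i s)(q - p)` with `s ≠ 0` is off the segment `[p, q]`. [folklore] -/
theorem not_mem_segment_of_offset (hpq : p ≠ q) (t : ℝ) {s : ℝ} (hs : s ≠ 0) :
    p + ((t : ℂ) + (s : ℂ) * Complex.I) * (q - p) ∉ segment ℝ p q := by
  intro h
  obtain ⟨u, -, hu⟩ := (mem_segment_iff_exists _).1 h
  have hqp : q - p ≠ 0 := sub_ne_zero.2 hpq.symm
  have h1 : ((t : ℂ) + (s : ℂ) * Complex.I) * (q - p) = (u : ℂ) * (q - p) := by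
    have := congrArg (fun w => w - p) hu
    simpa using this
  have h2 : (t : ℂ) + (s : ℂ) * Complex.I = (u : ℂ) := mul_right_cancel₀ hqp h1
  have := congrArg Complex.im h2
  simp at this
  exact hs this

end Segment

/-! ### The slit domain `D ∖ [p, q]` -/

section Slit

variable (D : DobrushinDomain) {p q : ℂ}

/-- A point `p + t (q - p)` of the open domain (real `t`) lies in the closure of the slit domain
`D ∖ [p, q]`: approach it sideways by `p + (t + i s)(q - p)`, `s → 0⁺`. [folklore] -/
theorem lineMap_mem_closure_slit (hpq : p ≠ q) {t : ℝ} (ht : p + (t : ℂ) * (q - p) ∈ D.carrier) :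
    p + (t : ℂ) * (q - p) ∈ closure (D.carrier \ segment ℝ p q) := by
  set z : ℝ → ℂ := fun s => p + ((t : ℂ) + (s : ℂ) * Complex.I) * (q - p) with hz
  have hz0 : z 0 = p + (t : ℂ) * (q - p) := by simp [hz]
  have hcont : Continuous z := by
    simp only [hz]
    fun_prop
  have htend : Tendsto z (𝓝[>] 0) (𝓝 (p + (t : ℂ) * (q - p))) := by
    rw [← hz0]
    exact (hcont.tendsto 0).mono_left nhdsWithin_le_nhds
  refine mem_closure_of_tendsto htend ?_
  have hopen : ∀ᶠ s : ℝ in 𝓝 0, z s ∈ D.carrier := by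
    have : z ⁻¹' D.carrier ∈ 𝓝 (0 : ℝ) :=
      hcont.continuousAt.preimage_mem_nhds (by rw [hz0]; exact D.isOpen.mem_nhds ht)
    exact this
  filter_upwards [self_mem_nhdsWithin, nhdsWithin_le_nhds hopen] with s (hs : 0 < s) hsD
  exact ⟨hsD, not_mem_segment_of_offset hpq t hs.ne'⟩

/-- The frontier of the slit domain lies in `frontier D ∪ [p, q]`. [folklore] -/
theorem frontier_slit_subset :
    frontier (D.carrier \ segment ℝ p q) ⊆ frontier D.carrier ∪ segment ℝ p q := by
  intro z hz
  have hU : IsOpen (D.carrier \ segment ℝ p q) := D.isOpen.sdiff (by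
    rw [segment_eq_image_lineMap]; exact (isCompact_Icc.image AffineMap.lineMap_continuous).isClosed)
  rw [hU.frontier_eq] at hz
  obtain ⟨hcl, hnot⟩ := hz
  by_cases hzD : z ∈ D.carrier
  · right
    by_contra hzs
    exact hnot ⟨hzD, hzs⟩
  · left
    rw [D.isOpen.frontier_eq]
    exact ⟨closure_mono (fun x hx => hx.1) hcl, hzD⟩

/-- Points `p + t (q - p)`, `t ∈ [1/2, 1]`, lie on the sub-segment `[m, q]`, `m` the midpoint. [folklore] -/
theorem lineMap_mem_segment_mid {t : ℝ} (ht1 : 1 / 2 ≤ t) (ht2 : t ≤ 1) :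
    p + (t : ℂ) * (q - p) ∈ segment ℝ (p + ((1 / 2 : ℝ) : ℂ) * (q - p)) q := by
  refine (mem_segment_iff_exists _).2 ⟨2 * t - 1, ⟨by linarith, by linarith⟩, ?_⟩
  push_cast
  ring

/-- **THE FIRST STEP ALREADY LEAVES THE HYPOTHESIS CLASS (W1 for every domain).** For every
Dobrushin domain `D`, every frontier point `p` and every `q ≠ p` such that the half-open segment
`(p, q]` lies in `D`, the slit domain `D ∖ [p, q]` — the domain left after a first exploration
step along `[p, q]` — is the carrier of NO Dobrushin domain (the midpoint of the slit is a cut point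
of its frontier).  Hence `HexObservableLimit` (quantified over `DobrushinDomain`) is silent from
the very first step of every exploration in every domain, not only for the slit disc. [folklore] -/
theorem slitSegment_ne_carrier (D' : DobrushinDomain) (hpq : p ≠ q)
    (hseg : ∀ t ∈ Set.Ioc (0 : ℝ) 1, p + (t : ℂ) * (q - p) ∈ D.carrier) :
    D'.carrier ≠ D.carrier \ segment ℝ p q := by
  set U : Set ℂ := D.carrier \ segment ℝ p q with hU
  set m : ℂ := p + ((1 / 2 : ℝ) : ℂ) * (q - p) with hm
  -- the affine coordinate along `[p, q]`
  set ℓ : ℂ → ℝ := fun z => (conj (q - p) * (z - p)).re / ‖q - p‖ ^ 2 with hℓ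
  have hℓc : Continuous ℓ := by rw [hℓ]; fun_prop
  have hℓt : ∀ t : ℝ, ℓ (p + (t : ℂ) * (q - p)) = t := by
    intro t
    have hn : ‖q - p‖ ≠ 0 := norm_ne_zero_iff.2 (sub_ne_zero.2 hpq.symm)
    have h1 : conj (q - p) * (p + (t : ℂ) * (q - p) - p) = (t : ℂ) * (‖q - p‖ : ℂ) ^ 2 := by
      rw [add_sub_cancel_left, mul_left_comm, Complex.conj_mul']
    have h2 : ((t : ℂ) * (‖q - p‖ : ℂ) ^ 2).re = t * ‖q - p‖ ^ 2 := by
      rw [← Complex.ofReal_pow, ← Complex.ofReal_mul, Complex.ofReal_re]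
    simp only [hℓ]
    rw [h1, h2, mul_div_assoc, div_self (pow_ne_zero 2 hn), mul_one]
  have hmD : m ∈ D.carrier := hseg _ ⟨by norm_num, by norm_num⟩
  have hqD' : p + ((1 : ℝ) : ℂ) * (q - p) ∈ D.carrier := hseg 1 ⟨one_pos, le_rfl⟩
  have hq_eq : p + ((1 : ℝ) : ℂ) * (q - p) = q := by push_cast; ring
  have hp_eq : p + ((0 : ℝ) : ℂ) * (q - p) = p := by push_cast; ring
  -- the affine coordinate at the three points
  have h0 : ℓ p = 0 := by simpa [hp_eq] using hℓt 0
  have hhalf : ℓ m = 1 / 2 := hℓt _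
  have h1 : ℓ q = 1 := by simpa [hq_eq] using hℓt 1
  have hpm : p ≠ m := fun h => by have := congrArg ℓ h; rw [h0, hhalf] at this; norm_num at this
  have hqm : q ≠ m := fun h => by have := congrArg ℓ h; rw [h1, hhalf] at this; norm_num at this
  -- closure memberships
  have hm_cl : m ∈ closure U := lineMap_mem_closure_slit D hpq hmD
  have hq_cl : q ∈ closure U := by simpa [hq_eq] using lineMap_mem_closure_slit D hpq hqD'
  have hp_cl : p ∈ closure U := by
    have hcont : Continuous fun t : ℝ => p + (t : ℂ) * (q - p) := by fun_prop
    have htend : Tendsto (fun t : ℝ => p + (t : ℂ) * (q - p)) (𝓝[>] 0) (𝓝 p) := by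
      have := (hcont.tendsto 0).mono_left (nhdsWithin_le_nhds (s := Set.Ioi (0 : ℝ)))
      simpa [hp_eq] using this
    refine isClosed_closure.mem_of_tendsto htend ?_
    filter_upwards [Ioc_mem_nhdsGT one_pos] with t ht
    exact lineMap_mem_closure_slit D hpq (hseg t ht)
  -- frontier memberships
  have hUo : IsOpen U := D.isOpen.sdiff (by
    rw [segment_eq_image_lineMap]; exact (isCompact_Icc.image AffineMap.lineMap_continuous).isClosed)
  have hfrU : ∀ z, z ∈ closure U → z ∈ segment ℝ p q → z ∈ frontier U := fun z hz1 hz2 => by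
    rw [hUo.frontier_eq]
    exact ⟨hz1, fun h => h.2 hz2⟩
  have hm_fr : m ∈ frontier U :=
    hfrU m hm_cl ((mem_segment_iff_exists m).2 ⟨1 / 2, ⟨by norm_num, by norm_num⟩, rfl⟩)
  have hq_fr : q ∈ frontier U := hfrU q hq_cl (right_mem_segment _ _ _)
  have hp_fr : p ∈ frontier U := hfrU p hp_cl (left_mem_segment _ _ _)
  -- the cut at `m`
  apply carrier_ne_of_cutPoint D' hm_fr
  intro hpre
  set K₂ : Set ℂ := segment ℝ m q with hK₂
  have hK₂D : K₂ ⊆ D.carrier := by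
    intro z hz
    obtain ⟨u, hu, rfl⟩ := (mem_segment_iff_exists z).1 hz
    have : m + (u : ℂ) * (q - m) = p + (((1 + u) / 2 : ℝ) : ℂ) * (q - p) := by
      simp only [hm]; push_cast; ring
    rw [this]
    exact hseg _ ⟨by linarith [hu.1], by linarith [hu.2]⟩
  obtain ⟨ε₀, hε₀, hthick⟩ := (show IsCompact K₂ by
    rw [hK₂, segment_eq_image_lineMap]; exact isCompact_Icc.image AffineMap.lineMap_continuous).exists_thickening_subset_open D.isOpen hK₂D
  have hK₂ne : K₂.Nonempty := ⟨m, left_mem_segment _ _ _⟩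
  have hfar : ∀ z, z ∈ frontier D.carrier → ε₀ ≤ Metric.infDist z K₂ := fun z hz =>
    le_of_not_gt fun hQQ =>
      ((D.isOpen.frontier_eq ▸ hz).2) (hthick ((Metric.mem_thickening_iff_infDist_lt hK₂ne).2 hQQ))
  set O₁ : Set ℂ := {z | ℓ z < 1 / 2} ∪ {z | ε₀ / 4 < Metric.infDist z K₂} with hO₁
  set O₂ : Set ℂ := {z | 1 / 2 < ℓ z} ∩ {z | Metric.infDist z K₂ < ε₀ / 2} with hO₂
  have hO₁o : IsOpen O₁ := (isOpen_lt hℓc continuous_const).union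
    (isOpen_lt continuous_const (Metric.continuous_infDist_pt K₂))
  have hO₂o : IsOpen O₂ := (isOpen_lt continuous_const hℓc).inter
    (isOpen_lt (Metric.continuous_infDist_pt K₂) continuous_const)
  have hcover : frontier U \ {m} ⊆ O₁ ∪ O₂ := by
    rintro z ⟨hz, hzm⟩
    rcases frontier_slit_subset D hz with hzfr | hzseg
    · left; right
      show ε₀ / 4 < Metric.infDist z K₂
      linarith [hfar z hzfr]
    · obtain ⟨t, ht, rfl⟩ := (mem_segment_iff_exists z).1 hzseg
      rcases lt_trichotomy t (1 / 2) with hlt | heq | hgt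
      · left; left
        show ℓ _ < 1 / 2
        rw [hℓt]
        exact hlt
      · exact absurd (Set.mem_singleton_iff.2 (by rw [heq])) hzm
      · right
        refine ⟨?_, ?_⟩
        · show 1 / 2 < ℓ _
          rw [hℓt]
          exact hgt
        · show Metric.infDist _ K₂ < ε₀ / 2
          rw [Metric.infDist_zero_of_mem (lineMap_mem_segment_mid hgt.le ht.2)]
          positivity
  have hne1 : ((frontier U \ {m}) ∩ O₁).Nonempty :=
    ⟨p, ⟨hp_fr, fun h => hpm h⟩, Or.inl (show ℓ p < 1 / 2 by rw [h0]; norm_num)⟩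
  have hne2 : ((frontier U \ {m}) ∩ O₂).Nonempty := by
    refine ⟨q, ⟨hq_fr, fun h => hqm h⟩, ?_, ?_⟩
    · show 1 / 2 < ℓ q
      rw [h1]; norm_num
    · show Metric.infDist q K₂ < ε₀ / 2
      rw [Metric.infDist_zero_of_mem (right_mem_segment _ _ _)]
      positivity
  obtain ⟨z, ⟨hzfrU, -⟩, hz1, hz2a, hz2b⟩ := hpre O₁ O₂ hO₁o hO₂o hcover hne1 hne2
  have hz2a : 1 / 2 < ℓ z := hz2a
  have hz2b : Metric.infDist z K₂ < ε₀ / 2 := hz2b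
  rcases hz1 with hz1 | hz1
  · have hz1 : ℓ z < 1 / 2 := hz1
    linarith
  · have hz1 : ε₀ / 4 < Metric.infDist z K₂ := hz1
    rcases frontier_slit_subset D hzfrU with hzfr | hzseg
    · linarith [hfar z hzfr]
    · obtain ⟨t, ht, rfl⟩ := (mem_segment_iff_exists z).1 hzseg
      rw [hℓt] at hz2a
      rw [Metric.infDist_zero_of_mem (lineMap_mem_segment_mid hz2a.le ht.2)] at hz1
      linarith

end Slit

end Summit.CriticalPhenomena.SAWScalingLimit.Theorems.ObservableToSLE.Negative
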